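import Literature.MathematicalPhysics.QuantumFieldTheory.Balaban1983to89.B9Eq340ContourLasso

/-!
# `Balaban1983to89.B9Eq340TaxiForward` — T. Bałaban, *Propagators for lattice gauge theories in a background field*, Commun. Math. Phys. **99** (1985) 389–434
# [Balaban1985BackgroundPropagators], (3.40) p. 397 with (3.3) p. 391 and (3.35) p. 396: def-Y's TAXICAB TRANSPORTER IN THE FORWARD REGIME IS A MULTI-LEG STRAIGHT
# CONTOUR, and THE LASSO `U(Γ_{x,z})·U_κ(z)·U(Γ_{x,z+e_κ})⁻¹` IS A CONJUGATE OF THE LASSO OF THE LEGS `> κ` — hence within `Σ (swept plaquette defects)` of `1`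

statement-level skeleton of published theorems with citation tags; proofs where landed; nothing here is a claim about the Yang–Mills mass gap

THE PRINT.  (3.40) p. 397 (transport along «a shortest contour Γ_{x,x′}»; def-Y's `Node00.OpsYTransport.parTaxiV`: legs in the directions `0, …, d−1`, the shorter way round);
(3.3) p. 391; (3.35) p. 396.

WHY THIS FILE (dag-n06-i gen 13, N06 bundle F4, row 26, step F-b(ii)-b of the (P′1) roadmap).  The covariant difference of a transported tent across the bond `⟨z, z+e_κ⟩` is governed
by `W = τ(z)·U_κ(z)·τ(z+e_κ)⁻¹`, `τ(·) = parTaxiV U x ·`.  In the FORWARD REGIME (every leg goes forward — inside a double block ahead of the block corner `x`, no wrapping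
round the torus) the contour to `z` is the multi-leg straight contour with leg lengths `a_μ = (z_μ − x_μ).val`, the contour to `z + e_κ` has the leg `κ` one bond longer and the
legs `> κ` translated; so `W = π·(lasso of the legs > κ)·π⁻¹` and `B9Eq340ContourLasso.norm_lasso_sub_one_le` bounds `‖W − 1‖` by the plaquette variables swept.

WHAT IS PROVED (sorry-free, 0 def).
* §1 `taxiLegV_of_fwd` (the forward branch), ★ `taxiRun_eq_legRun` (a nodup list of forward legs runs as `legRun` with lengths `a_μ = (z_μ − x_μ).val`), ★ `parTaxiV_eq_legRun`.
* §2 `legRun_append`, `legEnd_append`, `parFwdV_succ_right` (`parFwdV U κ (a+1) w = parFwdV U κ a w · U_κ(w + a e_κ)`), `legRun_congr` (legs agree off `κ`).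
* §3 ★★★ `norm_taxiLasso_sub_one_le` — unitary-like `U`, forward regime at `z` and at `z + e_κ`, no wrap in direction `κ`:
  `‖parTaxiV U x z · U_κ(z) · (parTaxiV U x (z+e_κ))⁻¹ − 1‖ ≤ legDefect κ U L₂ w` for the explicit legs `L₂` (directions after `κ` in `finRange d`) from the explicit point `w`,
  and the uniform corollary `… ≤ (Σ_{μ>κ… } a_μ)·δ ≤ (d · max a)·δ` when every `p_{νκ}` plaquette variable is `δ`-close to `1` (`norm_taxiLasso_sub_one_le_of_uniform`).

HONEST SCOPE.  Elementary bookkeeping over def-Y's `parTaxiV`; the forward-regime ∕ no-wrap hypotheses are DISPLAYED (they hold inside a double block of side `2Lʲ < period∕2` ahead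
of its corner — not proved here); the plaquette smallness is n06-j's `B9Eq335PlaquetteAtLettersY`; nothing of [B9] asserted; count-neutral; N06 NOT discharged.  Cell `pub-ymgap`
(HUMAN RULING D-0062), Track A node N06 [B9], seat `pub-ymgap-dag-n06-i` (gen 13), 2026-08-27; a NEW file.
-/

namespace Literature.MathematicalPhysics.QuantumFieldTheory.Balaban1983to89.B9Eq340TaxiForward

open Finset
open T4RelativeLadder (UnitaryLike norm_conj_sub_one_eq)
open B9Eq340LadderHolonomy (contourProd contourProd_succ)
open B9Eq340ContourLasso (legRun legEnd legDefect lasso norm_lasso_sub_one_le unitaryLike_legRun unitaryLike_parFwdV parFwdV_eq_contourProd legDefect_le_of_uniform)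
open B9BackgroundsKLevelV1 (CfgV1 shiftsV1)
open B9Eq39Adjoint (plaqU)
open Node00 (parFwdV parFwdV_succ taxiLegV taxiRun parTaxiV iterate_shift_apply)

variable {P : Params} {𝔸 : Type} [NormedRing 𝔸]

/-! ## §1 The forward regime: `parTaxiV` is a multi-leg straight contour -/

/-- the forward branch of one leg. [cite: Balaban1985BackgroundPropagators, (3.40) p.397, bookkeeping] -/
theorem taxiLegV_of_fwd (U : CfgV1 P 𝔸) (z : Site P 0) (s : Site P 0 × 𝔸ˣ) (μ : Fin P.d) (h : (z μ - s.1 μ).val ≤ (s.1 μ - z μ).val) :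
    taxiLegV U z s μ = ((fun y : Site P 0 => y.shift μ)^[(z μ - s.1 μ).val] s.1, s.2 * parFwdV U μ (z μ - s.1 μ).val s.1) := by
  unfold taxiLegV; rw [if_pos h]

/-- ★ a nodup list of forward legs runs as `legRun` with the lengths `a_μ = (z_μ − x_μ).val` read off the START `x`. [cite: Balaban1985BackgroundPropagators, (3.40) p.397] -/
theorem taxiRun_eq_legRun (U : CfgV1 P 𝔸) (x z : Site P 0) (hf : ∀ μ, (z μ - x μ).val ≤ (x μ - z μ).val) :
    ∀ (l : List (Fin P.d)), l.Nodup → ∀ s : Site P 0 × 𝔸ˣ, (∀ μ ∈ l, s.1 μ = x μ) →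
      taxiRun U z l s = (legEnd (l.map fun μ => (μ, (z μ - x μ).val)) s.1, s.2 * legRun U (l.map fun μ => (μ, (z μ - x μ).val)) s.1) := by
  intro l
  induction l with
  | nil => intro _ s _; simp [taxiRun, legRun, legEnd]
  | cons μ l ih =>
    intro hnd s hs
    rw [List.nodup_cons] at hnd
    have hμ : s.1 μ = x μ := hs μ (by simp)
    have hleg := taxiLegV_of_fwd U z s μ (by rw [hμ]; exact hf μ)
    rw [hμ] at hleg
    simp only [taxiRun, List.foldl_cons, List.map_cons, legRun, legEnd] at ih ⊢
    rw [hleg, ih hnd.2]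
    · rw [mul_assoc]
    · intro ν hν
      have hνμ : ν ≠ μ := fun h => hnd.1 (h ▸ hν)
      show ((fun y : Site P 0 => y.shift μ)^[(z μ - x μ).val] s.1) ν = x ν
      rw [iterate_shift_apply, if_neg hνμ, hs ν (by simp [hν])]

/-- ★ **IN THE FORWARD REGIME `parTaxiV` IS THE MULTI-LEG STRAIGHT CONTOUR** with legs `(μ, (z_μ − x_μ).val)`, `μ = 0, …, d−1`. [cite: Balaban1985BackgroundPropagators, (3.40) p.397, (3.3) p.391] -/
theorem parTaxiV_eq_legRun (U : CfgV1 P 𝔸) (x z : Site P 0) (hf : ∀ μ, (z μ - x μ).val ≤ (x μ - z μ).val) :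
    parTaxiV U x z = legRun U ((List.finRange P.d).map fun μ => (μ, (z μ - x μ).val)) x := by
  have h := taxiRun_eq_legRun U x z hf (List.finRange P.d) (List.nodup_finRange _) (x, 1) (fun _ _ => rfl)
  unfold parTaxiV; rw [h, one_mul]

/-! ## §2 Splitting the legs at `κ` -/

/-- legs concatenate. [cite: Balaban1985BackgroundPropagators, (3.3) p.391, bookkeeping] -/
theorem legRun_append (U : CfgV1 P 𝔸) (l₁ l₂ : List (Fin P.d × ℕ)) (z : Site P 0) :
    legRun U (l₁ ++ l₂) z = legRun U l₁ z * legRun U l₂ (legEnd l₁ z) := by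
  induction l₁ generalizing z with
  | nil => simp [legRun, legEnd]
  | cons p l ih => obtain ⟨ν, n⟩ := p; simp only [List.cons_append, legRun, legEnd, ih, mul_assoc]

/-- endpoints concatenate. [cite: Balaban1985BackgroundPropagators, (3.40) p.397, bookkeeping] -/
theorem legEnd_append (l₁ l₂ : List (Fin P.d × ℕ)) (z : Site P 0) : legEnd l₂ (legEnd l₁ z) = legEnd (l₁ ++ l₂) z := by
  induction l₁ generalizing z with
  | nil => rfl
  | cons p l ih => obtain ⟨ν, n⟩ := p; exact ih _

/-- one more bond at the END of a straight leg. [cite: Balaban1985BackgroundPropagators, (3.3) p.391, bookkeeping] -/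
theorem parFwdV_succ_right (U : CfgV1 P 𝔸) (κ : Fin P.d) (a : ℕ) (w : Site P 0) :
    parFwdV U κ (a + 1) w = parFwdV U κ a w * U κ ((fun y : Site P 0 => y.shift κ)^[a] w) := by
  rw [parFwdV_eq_contourProd, parFwdV_eq_contourProd, contourProd_succ]

/-- legs read off two targets that agree in the listed directions coincide. [cite: Balaban1985BackgroundPropagators, (3.40) p.397, bookkeeping] -/
theorem map_legs_congr {z z' x : Site P 0} {l : List (Fin P.d)} (h : ∀ μ ∈ l, z' μ = z μ) :
    (l.map fun μ => (μ, (z' μ - x μ).val)) = l.map fun μ => (μ, (z μ - x μ).val) :=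
  List.map_congr_left fun μ hμ => by rw [h μ hμ]

/-! ## §3 ★★★ The taxicab lasso across one bond -/

/-- ★★★ **THE TAXICAB LASSO IS A CONJUGATE OF THE LASSO OF THE LATER LEGS**: in the forward regime at `z` and at `z + e_κ`, with no wrap in direction `κ`,
`parTaxiV U x z · U_κ(z) · (parTaxiV U x (z+e_κ))⁻¹ = π · lasso κ U L₂ w · π⁻¹` where, writing `finRange d = l₁ ++ κ :: l₂`, `L₂` = the legs of `l₂`, `w` = the point after the legs
`l₁` and `a_κ` bonds in direction `κ`, `π` = the transporter up to `w`. [cite: Balaban1985BackgroundPropagators, (3.40) p.397, (3.3) p.391] -/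
theorem taxiLasso_eq_conj {U : CfgV1 P 𝔸} {x z : Site P 0} {κ : Fin P.d}
    (hf : ∀ μ, (z μ - x μ).val ≤ (x μ - z μ).val) (hf' : ∀ μ, ((z.shift κ) μ - x μ).val ≤ (x μ - (z.shift κ) μ).val)
    (hwrap : ((z.shift κ) κ - x κ).val = (z κ - x κ).val + 1) {l₁ l₂ : List (Fin P.d)} (hl : List.finRange P.d = l₁ ++ κ :: l₂) :
    parTaxiV U x z * U κ z * (parTaxiV U x (z.shift κ))⁻¹ =
      (legRun U (l₁.map fun μ => (μ, (z μ - x μ).val)) x * parFwdV U κ (z κ - x κ).val (legEnd (l₁.map fun μ => (μ, (z μ - x μ).val)) x)) *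
        lasso κ U (l₂.map fun μ => (μ, (z μ - x μ).val))
          ((fun y : Site P 0 => y.shift κ)^[(z κ - x κ).val] (legEnd (l₁.map fun μ => (μ, (z μ - x μ).val)) x)) *
        (legRun U (l₁.map fun μ => (μ, (z μ - x μ).val)) x * parFwdV U κ (z κ - x κ).val (legEnd (l₁.map fun μ => (μ, (z μ - x μ).val)) x))⁻¹ := by
  have hnd : (l₁ ++ κ :: l₂).Nodup := hl ▸ List.nodup_finRange _
  have hκ1 : κ ∉ l₁ := fun h => (List.nodup_append.1 hnd).2.2 _ h _ (by simp) rfl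
  have hκ2 : κ ∉ l₂ := fun h => ((List.nodup_append.1 hnd).2.1 |> List.nodup_cons.1).1 h
  have e1 : ∀ μ ∈ l₁, (z.shift κ) μ = z μ := fun μ hμ => by
    have : μ ≠ κ := fun h => hκ1 (h ▸ hμ)
    simp [Site.shift, this]
  have e2 : ∀ μ ∈ l₂, (z.shift κ) μ = z μ := fun μ hμ => by
    have : μ ≠ κ := fun h => hκ2 (h ▸ hμ)
    simp [Site.shift, this]
  -- both transporters as multi-leg contours split at `κ`
  rw [parTaxiV_eq_legRun U x z hf, parTaxiV_eq_legRun U x (z.shift κ) hf', hl, List.map_append, List.map_append, List.map_cons, List.map_cons,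
    map_legs_congr e1, map_legs_congr e2, hwrap, legRun_append, legRun_append, legRun, legRun, parFwdV_succ_right, Function.iterate_succ_apply']
  -- the endpoint of the whole contour to `z` is `z`
  have hend : legEnd (l₂.map fun μ => (μ, (z μ - x μ).val))
      ((fun y : Site P 0 => y.shift κ)^[(z κ - x κ).val] (legEnd (l₁.map fun μ => (μ, (z μ - x μ).val)) x)) = z := by
    have h := taxiRun_eq_legRun U x z hf (List.finRange P.d) (List.nodup_finRange _) (x, 1) (fun _ _ => rfl)
    have h1 := congrArg Prod.fst h
    rw [show (taxiRun U z (List.finRange P.d) (x, 1)).1 = Node00.taxiEnd U x z from rfl, Node00.taxiEnd_eq] at h1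
    rw [hl, List.map_append, List.map_cons, ← legEnd_append] at h1
    exact h1.symm
  simp only [lasso, hend, mul_inv_rev]
  group

/-- ★★★ **THE TAXICAB LASSO IS SMALL WHERE THE PLAQUETTES ARE**: unitary-like bond variables, forward regime at `z` and `z + e_κ`, no wrap in direction `κ` ⇒
`‖parTaxiV U x z · U_κ(z) · (parTaxiV U x (z+e_κ))⁻¹ − 1‖ ≤ legDefect κ U L₂ w` (the plaquette defects swept by translating the legs after `κ`).
[cite: Balaban1985BackgroundPropagators, (3.40) p.397, (3.35) p.396; Balaban1985Averaging, (44)–(47) pp.24–25] -/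
theorem norm_taxiLasso_sub_one_le [NormOneClass 𝔸] {U : CfgV1 P 𝔸} (hU : ∀ μ y, UnitaryLike (U μ y)) {x z : Site P 0} {κ : Fin P.d}
    (hf : ∀ μ, (z μ - x μ).val ≤ (x μ - z μ).val) (hf' : ∀ μ, ((z.shift κ) μ - x μ).val ≤ (x μ - (z.shift κ) μ).val)
    (hwrap : ((z.shift κ) κ - x κ).val = (z κ - x κ).val + 1) {l₁ l₂ : List (Fin P.d)} (hl : List.finRange P.d = l₁ ++ κ :: l₂) :
    ‖((parTaxiV U x z * U κ z * (parTaxiV U x (z.shift κ))⁻¹ : 𝔸ˣ) : 𝔸) - 1‖ ≤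
      legDefect κ U (l₂.map fun μ => (μ, (z μ - x μ).val))
        ((fun y : Site P 0 => y.shift κ)^[(z κ - x κ).val] (legEnd (l₁.map fun μ => (μ, (z μ - x μ).val)) x)) := by
  rw [taxiLasso_eq_conj hf hf' hwrap hl, Units.val_mul, Units.val_mul]
  have hπ : UnitaryLike (legRun U (l₁.map fun μ => (μ, (z μ - x μ).val)) x *
      parFwdV U κ (z κ - x κ).val (legEnd (l₁.map fun μ => (μ, (z μ - x μ).val)) x)) :=
    (unitaryLike_legRun hU _ _).mul (unitaryLike_parFwdV hU _ _ _)
  rw [norm_conj_sub_one_eq hπ]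
  exact norm_lasso_sub_one_le hU κ _ _

/-- uniform corollary: if every plaquette variable `U(∂p_{νκ}(y))` is `δ`-close to `1`, the taxicab lasso is within `(Σ_{μ ∈ l₂} a_μ)·δ` of `1`.
[cite: Balaban1985BackgroundPropagators, (3.40) p.397, (3.35) p.396] -/
theorem norm_taxiLasso_sub_one_le_of_uniform [NormOneClass 𝔸] {U : CfgV1 P 𝔸} (hU : ∀ μ y, UnitaryLike (U μ y)) {x z : Site P 0} {κ : Fin P.d}
    (hf : ∀ μ, (z μ - x μ).val ≤ (x μ - z μ).val) (hf' : ∀ μ, ((z.shift κ) μ - x μ).val ≤ (x μ - (z.shift κ) μ).val)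
    (hwrap : ((z.shift κ) κ - x κ).val = (z κ - x κ).val + 1) {l₁ l₂ : List (Fin P.d)} (hl : List.finRange P.d = l₁ ++ κ :: l₂)
    {δ : ℝ} (hδ : ∀ ν y, ‖(plaqU (shiftsV1 P) U ν κ y : 𝔸) - 1‖ ≤ δ) :
    ‖((parTaxiV U x z * U κ z * (parTaxiV U x (z.shift κ))⁻¹ : 𝔸ˣ) : 𝔸) - 1‖ ≤ ((l₂.map fun μ => (z μ - x μ).val).sum : ℕ) * δ := by
  refine (norm_taxiLasso_sub_one_le hU hf hf' hwrap hl).trans ?_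
  have h := legDefect_le_of_uniform κ U hδ (l₂.map fun μ => (μ, (z μ - x μ).val))
    ((fun y : Site P 0 => y.shift κ)^[(z κ - x κ).val] (legEnd (l₁.map fun μ => (μ, (z μ - x μ).val)) x))
  rw [List.map_map] at h
  exact h

end Literature.MathematicalPhysics.QuantumFieldTheory.Balaban1983to89.B9Eq340TaxiForward
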